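import Mathlib
import Literature.NumberTheory.LFunctions.Zhang2022.TypedSection12A
import Literature.NumberTheory.LFunctions.Zhang2022.TypedSection12C
import Literature.NumberTheory.LFunctions.Zhang2022.SkeletonReductions
import Literature.NumberTheory.LFunctions.Zhang2022.SkeletonPartOneC
import Literature.NumberTheory.LFunctions.Zhang2022.Section3Lemma31
import Literature.NumberTheory.LFunctions.Zhang2022.SkeletonWindowPowers
import Literature.NumberTheory.LFunctions.Zhang2022.TypedSection01and02B
import HarnessLib

/-!
# Zhang (2022) §12, discharge layer I: sizes of `α`, `β_j`, `𝔞`, `P″₁`, `P″₂`, `ϰ₁₃`; (7.2) for `𝐚₁₅`, `𝐚₂₅`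

Topic `Literature/NumberTheory/LFunctions/Zhang2022` (Landau–Siegel audit tree; verdict-neutral).
Y. Zhang, *Discrete mean estimates and the Landau–Siegel zero*, arXiv:2211.02515v1 (2022)
[Zhang2022LandauSiegel]. **Status of the source: an unrefereed manuscript under adjudication** (campaign D-0069, cell
siegel-zhang). Everything in this file is PROVED (theorems only; no new definitions, no new facts);
nothing here is a claim about Theorems 1–2 of the source or about Landau–Siegel zeros.

This is the first of four files discharging the DEDUCTION `Z22:(12.17)` ("Finally, by (12.9), (12.15)
and (12.16) we conclude `Ξ₁₅ = (e₁* + 2e₂* + ε)𝔞𝔓`", §12 p. 73, tex L3713; skeleton leaf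
`Skeleton.Ded1217 c′` of `theorem1_of_leaves`, cone C33) from the typed CLAIM nodes of
`TypedSection12A` (L3-t4) and `TypedSection12C` (L3-t9). It collects the parameter sizes used downstream:

| decl | content | locator |
|---|---|---|
| `alpha_mul_logP`, `alpha_mul_ell_eq`, `alpha_mul_ell_le` | `α log P = π`, `α𝓛 = π𝓛⁻⁸ ≤ π` | (2.10) p. 9 |
| `norm_betaJ_le`, `norm_beta67`, `norm_betaJ_mul_betaJ_mul_logP_le` | `‖β_j‖ ≤ 3α(1+5|c′|π)`, `‖β_aβ_b‖log P ≤ 9π(1+5|c′|π)²α` | (2.13), (2.22); §10 p. 58 |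
| `frakA_le_ell_pow_four` | **`𝔞 ≤ (96e⁹/π²)𝓛⁴`** for `χ` primitive, `𝓛 ≥ 3` (unconditional; `Lemma31.norm_deriv_LFunction_le_near_one`) | (2.31) p. 11 |
| `P2pp_le_P_div_T_sq`, `ceil_P2pp_le_Nsupp`, `P3_le_P2` | `P″₂ ≤ PT⁻²` (`𝓛 ≥ 3`), `P₃ ≤ P₂` (`𝓛 ≥ 4`) | §12 p. 67, (7.2), (2.21) |
| `a12_eq_zero_of_P2_le`, `a22_eq_zero_of_P2_le` | `𝐚₁₂(n) = 𝐚₂₂(n) = 0` for `n ≥ P₂` | (9.2) |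
| `norm_vk13_le`, `adm72_a15`, `adm72_a25` | `|ϰ₁₃| ≤ 0.004/0.504`; **`𝐚₁₅`, `𝐚₂₅` satisfy (7.2)** with bound `1` | (12.9) p. 68, (7.2) |

## References

* Y. Zhang, arXiv:2211.02515v1 (2022), §2 (2.10), (2.13), (2.21), (2.22), (2.31); §7 (7.2); §12 p. 67–68.
  [cite: Zhang2022LandauSiegel, §12 pp. 67–68]
-/

noncomputable section

open Complex Real ComplexConjugate
open Literature.NumberTheory.LFunctions.Zhang2022
open Literature.NumberTheory.LFunctions.Zhang2022.Skeleton
open Literature.NumberTheory.LFunctions.Zhang2022.Typed.Sec12A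
open Literature.NumberTheory.LFunctions.Zhang2022.Typed.Sec12C

namespace Literature.NumberTheory.LFunctions.Zhang2022.Sec12D

/-! ## Sizes of the parameters `𝓛`, `α`, `β_j` -/

section Sizes

variable (c' : ℝ) {D : ℕ}

/-- `α log P = π` ((2.10): `α = π/log P`; `log P = 𝓛⁹ ≠ 0` once `𝓛 ≥ 1`).
[cite: Zhang2022LandauSiegel, §2 (2.10)] -/
theorem alpha_mul_logP (hD : 1 ≤ Real.log D) : alpha D * Real.log (bigP D) = π := by
  have h9 : Real.log (bigP D) ≠ 0 := by
    rw [Skeleton.log_bigP]; exact pow_ne_zero _ (by rw [ell]; linarith)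
  rw [alpha, div_mul_cancel₀ _ h9]

/-- `α𝓛 = π𝓛⁻⁸`. [cite: Zhang2022LandauSiegel, §2 (2.10)] -/
theorem alpha_mul_ell_eq (hD : 1 ≤ Real.log D) : alpha D * ell D = π * (ell D ^ 8)⁻¹ := by
  have h : ell D ≠ 0 := by rw [ell]; linarith
  rw [Section2.alpha_eq_pi_div_ell9]
  field_simp

/-- `α𝓛 ≤ π` (indeed `= π𝓛⁻⁸`). [cite: Zhang2022LandauSiegel, §2 (2.10)] -/
theorem alpha_mul_ell_le (hD : 1 ≤ Real.log D) : alpha D * ell D ≤ π := by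
  rw [alpha_mul_ell_eq hD]
  have h1 : 1 ≤ ell D ^ 8 := one_le_pow₀ (by rw [ell]; exact hD)
  have : (ell D ^ 8)⁻¹ ≤ 1 := inv_le_one_of_one_le₀ h1
  nlinarith [Real.pi_pos]

/-- `0 < α` once `𝓛 ≥ 1`. [cite: Zhang2022LandauSiegel, §2 (2.10)] -/
theorem alpha_pos_of_log (hD : 1 ≤ Real.log D) : 0 < alpha D := by
  rw [Section2.alpha_eq_pi_div_ell9]; exact div_pos Real.pi_pos (pow_pos (by rw [ell]; linarith) _)

/-- `α ≤ π` (crude). [cite: Zhang2022LandauSiegel, §2 (2.10)] -/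
theorem alpha_le_pi (hD : 1 ≤ Real.log D) : alpha D ≤ π := by
  rw [Section2.alpha_eq_pi_div_ell9]
  exact div_le_self Real.pi_pos.le (one_le_pow₀ (by rw [ell]; exact hD))

/-- The size of the perturbation `x = c′α𝓛` of (2.13): `|c′α𝓛| ≤ |c′|π`.
[cite: Zhang2022LandauSiegel, §2 (2.13)] -/
theorem abs_pert_le (hD : 1 ≤ Real.log D) : |c' * alpha D * ell D| ≤ |c'| * π := by
  rw [mul_assoc, abs_mul, abs_of_nonneg (mul_nonneg (alpha_pos_of_log hD).le (by rw [ell]; linarith))]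
  exact mul_le_mul_of_nonneg_left (alpha_mul_ell_le hD) (abs_nonneg _)

/-- `β_j` is one of `β₁, β₂, β₃`. [cite: Zhang2022LandauSiegel, §8 p. 45] -/
theorem betaJ_mem (D : ℕ) (j : ℕ) :
    betaJ c' D j = beta1 c' D ∨ betaJ c' D j = beta2 c' D ∨ betaJ c' D j = beta3 c' D := by
  unfold betaJ
  split_ifs <;> simp

/-- `‖β₁‖, ‖β₂‖, ‖β₃‖ ≤ 3α(1 + 5|c′|π)`. [cite: Zhang2022LandauSiegel, §2 (2.13)] -/
theorem norm_beta123_le (hD : 1 ≤ Real.log D) :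
    ‖beta1 c' D‖ ≤ 3 * alpha D * (1 + 5 * |c'| * π) ∧
      ‖beta2 c' D‖ ≤ 3 * alpha D * (1 + 5 * |c'| * π) ∧
      ‖beta3 c' D‖ ≤ 3 * alpha D * (1 + 5 * |c'| * π) := by
  have hα := alpha_pos_of_log hD
  have hx := abs_pert_le c' hD
  have hx' := abs_le.mp hx
  have hπ := Real.pi_pos
  have hc : 0 ≤ |c'| * π := by positivity
  refine ⟨?_, ?_, ?_⟩
  · rw [beta1, norm_mul, norm_mul, Complex.norm_I, one_mul, Complex.norm_real, Complex.norm_real,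
      Real.norm_of_nonneg hα.le, Real.norm_eq_abs]
    have : |1 - 5 * c' * alpha D * ell D| ≤ 1 + 5 * |c'| * π := by
      rw [abs_le]; constructor <;> nlinarith
    nlinarith [abs_nonneg (1 - 5 * c' * alpha D * ell D)]
  · rw [beta2, norm_mul, norm_mul, norm_mul, Complex.norm_I, Complex.norm_real, Complex.norm_real,
      Real.norm_of_nonneg hα.le, Real.norm_eq_abs, Complex.norm_two]
    have : |1 + c' * alpha D * ell D| ≤ 1 + 5 * |c'| * π := by
      rw [abs_le]; constructor <;> nlinarith
    nlinarith [abs_nonneg (1 + c' * alpha D * ell D)]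
  · rw [beta3, norm_mul, norm_mul, norm_mul, Complex.norm_I, Complex.norm_real, Complex.norm_real,
      Real.norm_of_nonneg hα.le, Real.norm_eq_abs]
    have h3 : ‖(3 : ℂ)‖ = 3 := by simp
    rw [h3]
    have : |1 - c' * alpha D * ell D| ≤ 1 + 5 * |c'| * π := by
      rw [abs_le]; constructor <;> nlinarith
    nlinarith [abs_nonneg (1 - c' * alpha D * ell D)]

/-- `‖β_j‖ ≤ 3α(1 + 5|c′|π)` for every index `j` (`β₄ = β₁, β₅ = β₂`).
[cite: Zhang2022LandauSiegel, §2 (2.13)] -/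
theorem norm_betaJ_le (hD : 1 ≤ Real.log D) (j : ℕ) :
    ‖betaJ c' D j‖ ≤ 3 * alpha D * (1 + 5 * |c'| * π) := by
  obtain ⟨h1, h2, h3⟩ := norm_beta123_le c' hD
  rcases betaJ_mem c' D j with h | h | h <;> rw [h] <;> assumption

/-- `‖β₆‖ = 3α/2`, `‖β₇‖ = 5α/2`. [cite: Zhang2022LandauSiegel, §2 (2.22)] -/
theorem norm_beta67 (hD : 1 ≤ Real.log D) :
    ‖beta6 D‖ = 3 * alpha D / 2 ∧ ‖beta7 D‖ = 5 * alpha D / 2 := by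
  have hα := alpha_pos_of_log hD
  constructor
  · rw [beta6, norm_div, norm_mul, norm_mul, Complex.norm_I, Complex.norm_real,
      Real.norm_of_nonneg hα.le, Complex.norm_two]
    have h3 : ‖(3 : ℂ)‖ = 3 := by simp
    rw [h3]; ring
  · rw [beta7, norm_div, norm_mul, norm_mul, Complex.norm_I, Complex.norm_real,
      Real.norm_of_nonneg hα.le, Complex.norm_two]
    have h5 : ‖(5 : ℂ)‖ = 5 := by simp
    rw [h5]; ring

/-- **`β_{j+1}β_{j+2} log P = O(α)`** (the size behind "`β_{j+1}β_{j+2}log P = −(11−6j+j²)πα + o(α)`",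
p. 58): `‖β_a β_b‖ log P ≤ 9π(1 + 5|c′|π)² α` for all indices. [cite: Zhang2022LandauSiegel, §10 p. 58] -/
theorem norm_betaJ_mul_betaJ_mul_logP_le (hD : 1 ≤ Real.log D) (a b : ℕ) :
    ‖betaJ c' D a * betaJ c' D b‖ * Real.log (bigP D) ≤
      9 * π * (1 + 5 * |c'| * π) ^ 2 * alpha D := by
  have hα := alpha_pos_of_log hD
  have hK : 0 ≤ 1 + 5 * |c'| * π := by positivity
  have hlog : 0 ≤ Real.log (bigP D) := by rw [Skeleton.log_bigP]; exact pow_nonneg (by rw [ell]; linarith) _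
  have ha := norm_betaJ_le c' hD a
  have hb := norm_betaJ_le c' hD b
  rw [norm_mul]
  calc ‖betaJ c' D a‖ * ‖betaJ c' D b‖ * Real.log (bigP D)
      ≤ (3 * alpha D * (1 + 5 * |c'| * π)) * (3 * alpha D * (1 + 5 * |c'| * π)) *
          Real.log (bigP D) := by gcongr
    _ = 9 * (1 + 5 * |c'| * π) ^ 2 * alpha D * (alpha D * Real.log (bigP D)) := by ring
    _ = 9 * π * (1 + 5 * |c'| * π) ^ 2 * alpha D := by rw [alpha_mul_logP hD]; ring

end Sizes

/-! ## `𝔞 ≪ 𝓛⁴` (unconditionally, for primitive `χ`) -/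

section FrakA

variable {D : ℕ} [NeZero D] (χ : DirichletCharacter ℂ D)

/-- **`𝔞 ≤ (96e⁹/π²)𝓛⁴`** for `χ` primitive and `𝓛 ≥ 3`: (2.31) `𝔞 = (6/π²)L′(1,χ)²∏_{q∣D}q/(q+1)`
with `∏ ≤ 1` and `|L′(1,χ)| ≤ 2e^{9/2}(1+𝓛)𝓛 ≤ 4e^{9/2}𝓛²` (the tree's Cauchy estimate
`Lemma31.norm_deriv_LFunction_le_near_one`). Unconditional (no Assumption (A)).
[cite: Zhang2022LandauSiegel, §2 (2.31)] -/
theorem frakA_le_ell_pow_four (hD : 3 ≤ Real.log D) (hχ : χ.IsPrimitive) :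
    frakA χ ≤ 96 * Real.exp 9 / π ^ 2 * ell D ^ 4 := by
  have hL0 : 0 ≤ Real.log D := by linarith
  have hder : ‖deriv χ.LFunction 1‖ ≤ 2 * Real.exp (9 / 2) * (1 + Real.log D) * Real.log D :=
    Lemma31.norm_deriv_LFunction_le_near_one χ hD hχ (w := 1) (by simp; positivity)
  have hre : |(deriv χ.LFunction 1).re| ≤ 2 * Real.exp (9 / 2) * (1 + Real.log D) * Real.log D :=
    (Complex.abs_re_le_norm _).trans hder
  have hsq : (deriv χ.LFunction 1).re ^ 2 ≤
      (2 * Real.exp (9 / 2) * (1 + Real.log D) * Real.log D) ^ 2 := by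
    rw [← sq_abs]
    exact pow_le_pow_left₀ (abs_nonneg _) hre 2
  have hprod : ∏ p ∈ D.primeFactors, ((p : ℝ) / (p + 1)) ≤ 1 := by
    refine Finset.prod_le_one (fun p _ => by positivity) fun p _ => ?_
    rw [div_le_one (by positivity)]; linarith
  have hprod0 : 0 ≤ ∏ p ∈ D.primeFactors, ((p : ℝ) / (p + 1)) :=
    Finset.prod_nonneg fun p _ => by positivity
  have he : Real.exp (9 / 2) ^ 2 = Real.exp 9 := by
    rw [sq, ← Real.exp_add]; norm_num
  have hπ := Real.pi_pos
  rw [frakA, Lemma171.frakA_def]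
  calc 6 / π ^ 2 * (deriv χ.LFunction 1).re ^ 2 * ∏ p ∈ D.primeFactors, ((p : ℝ) / (p + 1))
      ≤ 6 / π ^ 2 * (2 * Real.exp (9 / 2) * (1 + Real.log D) * Real.log D) ^ 2 * 1 := by
        gcongr
    _ = 24 / π ^ 2 * Real.exp 9 * ((1 + Real.log D) * Real.log D) ^ 2 := by
        rw [← he]; ring
    _ ≤ 24 / π ^ 2 * Real.exp 9 * (2 * Real.log D * Real.log D) ^ 2 := by
        gcongr
        · linarith
    _ = 96 * Real.exp 9 / π ^ 2 * Real.log D ^ 4 := by ring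
    _ = 96 * Real.exp 9 / π ^ 2 * ell D ^ 4 := by rw [ell]

end FrakA

/-! ## The scales `P″₂ ≤ PT⁻²`, `P₃ ≤ P₂`, and the size of `ϰ₁₃`, `𝐚₁₅`, `𝐚₂₅` -/

section Scales

variable {D : ℕ}

/-- `D > 0` as a real number once `𝓛 = log D ≥ 1` ((2.1)). [cite: Zhang2022LandauSiegel, §2 (2.1)] -/
theorem natCast_pos_of_one_le_log (hD : 1 ≤ Real.log D) : (0 : ℝ) < D := by
  rcases Nat.eq_zero_or_pos D with h | h
  · subst h; norm_num at hD
  · exact_mod_cast h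

/-- `(D : ℝ) = e^{𝓛}`. [cite: Zhang2022LandauSiegel, §2 (2.1)] -/
theorem natCast_eq_exp_ell (hD : 1 ≤ Real.log D) : (D : ℝ) = Real.exp (ell D) := by
  rw [ell, Real.exp_log (natCast_pos_of_one_le_log hD)]

/-- `t₀ = 𝓛⁵¹⁹ ≤ e^{519𝓛}`. [cite: Zhang2022LandauSiegel, §2 (2.8)] -/
theorem t0_le_exp (hD : 1 ≤ Real.log D) : t0 D ≤ Real.exp (519 * ell D) := by
  have h0 : 0 ≤ ell D := by rw [ell]; linarith
  have h1 : ell D ≤ Real.exp (ell D) := by linarith [Real.add_one_le_exp (ell D)]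
  have : Real.exp (519 * ell D) = Real.exp (ell D) ^ 519 := by
    rw [show (519 : ℝ) * ell D = ((519 : ℕ) : ℝ) * ell D by norm_num, Real.exp_nat_mul]
  rw [t0, this]
  exact pow_le_pow_left₀ h0 h1 519

/-- `P″₂ > 0`, `P″₁ > 0`. [cite: Zhang2022LandauSiegel, §12 p. 67] -/
theorem P1pp_pos (hD : 1 ≤ Real.log D) : 0 < P1pp D := by
  have hD0 := natCast_pos_of_one_le_log hD
  have ht : 0 < t0 D := by rw [t0]; exact pow_pos (by rw [ell]; linarith) _
  rw [P1pp]
  exact mul_pos (mul_pos (Real.rpow_pos_of_pos (Real.exp_pos _) _) hD0) ht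

/-- `P″₂ > 0`. [cite: Zhang2022LandauSiegel, §12 p. 67] -/
theorem P2pp_pos (hD : 1 ≤ Real.log D) : 0 < P2pp D := by
  have hD0 := natCast_pos_of_one_le_log hD
  have ht : 0 < t0 D := by rw [t0]; exact pow_pos (by rw [ell]; linarith) _
  rw [P2pp]
  exact mul_pos (mul_pos (Real.rpow_pos_of_pos (Real.exp_pos _) _) hD0) ht

/-- `P″₂/P″₁ = P^{0.004}`. [cite: Zhang2022LandauSiegel, §12 p. 67] -/
theorem P2pp_div_P1pp (hD : 1 ≤ Real.log D) : P2pp D / P1pp D = bigP D ^ (0.004 : ℝ) := by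
  have hD0 := natCast_pos_of_one_le_log hD
  have ht : 0 < t0 D := by rw [t0]; exact pow_pos (by rw [ell]; linarith) _
  have hP : 0 < bigP D := Skeleton.bigP_pos D
  have h1 : 0 < bigP D ^ (0.496 : ℝ) := Real.rpow_pos_of_pos hP _
  rw [P2pp, P1pp]
  rw [show bigP D ^ (0.5 : ℝ) * D * t0 D / (bigP D ^ (0.496 : ℝ) * D * t0 D) =
      bigP D ^ (0.5 : ℝ) / bigP D ^ (0.496 : ℝ) by field_simp]
  rw [← Real.rpow_sub hP]
  norm_num

/-- `log P₁ = 0.504 log P`. [cite: Zhang2022LandauSiegel, §2 (2.21)] -/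
theorem log_P1_eq_mul (D : ℕ) : Real.log (Skeleton.P1 D) = 0.504 * Real.log (bigP D) := by
  rw [Skeleton.P1, Real.log_rpow (Skeleton.bigP_pos D)]

/-- **`P″₂ ≤ PT⁻²`** for `𝓛 ≥ 3` (`0.5𝓛⁹ + 𝓛 + 519 log 𝓛 ≤ 𝓛⁹ − 2𝓛^{1.1}`): the support of `ϰ₁₃`
lies below the truncation `PT⁻²` of (7.2). [cite: Zhang2022LandauSiegel, §12 p. 68, §7 (7.2)] -/
theorem P2pp_le_P_div_T_sq (hD : 3 ≤ Real.log D) : P2pp D ≤ bigP D / bigT D ^ 2 := by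
  have hD1 : 1 ≤ Real.log D := by linarith
  have hℓ : 3 ≤ ell D := by rw [ell]; exact hD
  have h1 : (1 : ℝ) ≤ ell D := by linarith
  have h0 : (0 : ℝ) ≤ ell D := by linarith
  have hbound : P2pp D ≤ Real.exp (0.5 * ell D ^ 9 + 520 * ell D) := by
    rw [P2pp, natCast_eq_exp_ell hD1, bigP, ← Real.exp_mul,
      show 0.5 * ell D ^ 9 + 520 * ell D = (ell D ^ 9 * 0.5 + ell D) + 519 * ell D by ring,
      Real.exp_add, Real.exp_add]
    exact mul_le_mul_of_nonneg_left (t0_le_exp hD1) (by positivity)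
  refine hbound.trans ?_
  rw [bigP, bigT, ← Real.exp_nat_mul, ← Real.exp_sub, Real.exp_le_exp]
  have h11 : ell D ^ (1.1 : ℝ) ≤ ell D ^ (2 : ℝ) :=
    Real.rpow_le_rpow_of_exponent_le h1 (by norm_num)
  rw [Real.rpow_two] at h11
  have h7 : (3 : ℝ) ^ 7 ≤ ell D ^ 7 := pow_le_pow_left₀ (by norm_num) hℓ 7
  push_cast
  nlinarith [pow_nonneg h0 2, show ell D ^ 9 = ell D ^ 2 * ell D ^ 7 by ring,
    mul_le_mul_of_nonneg_left h7 (pow_nonneg h0 2)]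

/-- `⌈P″₂⌉ ≤ ⌈PT⁻²⌉ = Nsupp` for `𝓛 ≥ 3`. [cite: Zhang2022LandauSiegel, §7 (7.2)] -/
theorem ceil_P2pp_le_Nsupp (hD : 3 ≤ Real.log D) : ⌈P2pp D⌉₊ ≤ Nsupp D :=
  Nat.ceil_mono (P2pp_le_P_div_T_sq hD)

/-- **`P₃ ≤ P₂`** for `𝓛 ≥ 4` (`10𝓛^{1.1} ≤ 0.002𝓛⁹`), so `ϰ₂, ϰ₃` (hence `𝐚₁₂, 𝐚₂₂`) vanish
from `P₂` on. [cite: Zhang2022LandauSiegel, §2 (2.21)] -/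
theorem P3_le_P2 (hD : 4 ≤ Real.log D) : Skeleton.P3 D ≤ Skeleton.P2 D := by
  have hℓ : 4 ≤ ell D := by rw [ell]; exact hD
  have h1 : (1 : ℝ) ≤ ell D := by linarith
  have h0 : (0 : ℝ) ≤ ell D := by linarith
  rw [Skeleton.P3, Skeleton.P2, bigP, bigT, ← Real.exp_mul, ← Real.exp_mul, ← Real.exp_nat_mul,
    le_div_iff₀ (Real.exp_pos _), ← Real.exp_add, Real.exp_le_exp]
  have h11 : ell D ^ (1.1 : ℝ) ≤ ell D ^ (2 : ℝ) :=
    Real.rpow_le_rpow_of_exponent_le h1 (by norm_num)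
  rw [Real.rpow_two] at h11
  have h7 : (4 : ℝ) ^ 7 ≤ ell D ^ 7 := pow_le_pow_left₀ (by norm_num) hℓ 7
  push_cast
  nlinarith [pow_nonneg h0 2, show ell D ^ 9 = ell D ^ 2 * ell D ^ 7 by ring,
    mul_le_mul_of_nonneg_left h7 (pow_nonneg h0 2)]

/-- `𝐚₁₂(n) = 0` for `n ≥ P₂` (`𝓛 ≥ 4`). [cite: Zhang2022LandauSiegel, §9 (9.2), §2 (2.21)] -/
theorem a12_eq_zero_of_P2_le [NeZero D] (χ : DirichletCharacter ℂ D) (hD : 4 ≤ Real.log D) {n : ℕ}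
    (hn : Skeleton.P2 D ≤ n) : a12 χ n = 0 := by
  rw [a12, vk2_eq_zero hn, vk3_eq_zero ((P3_le_P2 hD).trans hn)]
  simp

/-- `𝐚₂₂(n) = 0` for `n ≥ P₂` (`𝓛 ≥ 4`). [cite: Zhang2022LandauSiegel, §9 (9.2), §2 (2.21)] -/
theorem a22_eq_zero_of_P2_le [NeZero D] (χ : DirichletCharacter ℂ D) (hD : 4 ≤ Real.log D) {n : ℕ}
    (hn : Skeleton.P2 D ≤ n) : a22 χ n = 0 := by
  rw [a22, a12_eq_zero_of_P2_le χ hD hn, map_zero]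

/-- **`|ϰ₁₃(n)| ≤ 0.004/0.504`** (display after (12.9): `|(n/P″₁)^{−β₆}| = 1`, `0 ≤ log(n/P″₁) <
log(P″₂/P″₁) = 0.004 log P`, `log P₁ = 0.504 log P`); `ϰ₁₃ = 0` off `(P″₁, P″₂)`.
[cite: Zhang2022LandauSiegel, §12 (12.9) p. 68] -/
theorem norm_vk13_le (hD : 1 ≤ Real.log D) (n : ℕ) : ‖vk13 D n‖ ≤ 0.004 / 0.504 := by
  rw [vk13]
  split_ifs with h
  · obtain ⟨h1, h2⟩ := h
    have hP1pp := P1pp_pos hD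
    have hr : 1 < (n : ℝ) / P1pp D := by rw [lt_div_iff₀ hP1pp]; linarith
    have hr0 : 0 < (n : ℝ) / P1pp D := by linarith
    have hlogP : 0 < Real.log (bigP D) := by
      rw [Skeleton.log_bigP]; exact pow_pos (by rw [ell]; linarith) _
    have hlogP1 : 0 < Real.log (Skeleton.P1 D) := by rw [log_P1_eq_mul]; positivity
    have hre : (-beta6 D).re = 0 := by simp [beta6]
    rw [norm_mul, norm_mul, Complex.norm_real, Complex.norm_real, Real.norm_of_nonneg
      (inv_nonneg.mpr hlogP1.le), Complex.norm_cpow_eq_rpow_re_of_pos hr0, hre, Real.rpow_zero,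
      mul_one, Real.norm_of_nonneg (Real.log_nonneg hr.le)]
    have hlt : Real.log ((n : ℝ) / P1pp D) ≤ 0.004 * Real.log (bigP D) := by
      have : (n : ℝ) / P1pp D ≤ P2pp D / P1pp D :=
        div_le_div_of_nonneg_right h2.le hP1pp.le
      calc Real.log ((n : ℝ) / P1pp D) ≤ Real.log (P2pp D / P1pp D) := Real.log_le_log hr0 this
        _ = 0.004 * Real.log (bigP D) := by
          rw [P2pp_div_P1pp hD, Real.log_rpow (Skeleton.bigP_pos D)]
    rw [log_P1_eq_mul]
    calc (0.504 * Real.log (bigP D))⁻¹ * Real.log ((n : ℝ) / P1pp D)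
        ≤ (0.504 * Real.log (bigP D))⁻¹ * (0.004 * Real.log (bigP D)) :=
          mul_le_mul_of_nonneg_left hlt (by positivity)
      _ = 0.004 / 0.504 := by field_simp
  · rw [norm_zero]; norm_num

/-- `ϰ₁₃(n) = 0` for `n ≥ P″₂`. [cite: Zhang2022LandauSiegel, §12 (12.9) p. 68] -/
theorem vk13_eq_zero_of_le {n : ℕ} (hn : P2pp D ≤ n) : vk13 D n = 0 := by
  rw [vk13, if_neg (fun h => (not_lt.mpr hn) h.2)]

/-- **`𝐚₁₅ = χϰ₁₃` satisfies (7.2)** with the bound `1` (for `𝓛 ≥ 3`: `|ϰ₁₃| ≤ 0.004/0.504`,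
support `< P″₂ ≤ PT⁻²`). [cite: Zhang2022LandauSiegel, §7 (7.2), §12 p. 68] -/
theorem adm72_a15 [NeZero D] (χ : DirichletCharacter ℂ D) (hD : 3 ≤ Real.log D) :
    Adm72 D 1 (a15 χ) := by
  have hD1 : 1 ≤ Real.log D := by linarith
  refine ⟨fun n => ?_, fun n hn => ?_⟩
  · rw [a15, norm_mul]
    calc ‖χ (n : ZMod D)‖ * ‖vk13 D n‖ ≤ 1 * (0.004 / 0.504) := by
          gcongr
          · exact DirichletCharacter.norm_le_one χ _
          · exact norm_vk13_le hD1 n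
      _ ≤ 1 := by norm_num
  · rw [a15, vk13_eq_zero_of_le ((P2pp_le_P_div_T_sq hD).trans hn), mul_zero]

/-- **`𝐚₂₅ = conj 𝐚₁₅` satisfies (7.2)** with the bound `1` (`𝓛 ≥ 3`).
[cite: Zhang2022LandauSiegel, §7 (7.2), §12 p. 68] -/
theorem adm72_a25 [NeZero D] (χ : DirichletCharacter ℂ D) (hD : 3 ≤ Real.log D) :
    Adm72 D 1 (a25 χ) := by
  obtain ⟨hb, hs⟩ := adm72_a15 χ hD
  refine ⟨fun n => ?_, fun n hn => ?_⟩
  · rw [a25, Complex.norm_conj]; exact hb n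
  · rw [a25, hs n hn, map_zero]

end Scales

end Literature.NumberTheory.LFunctions.Zhang2022.Sec12D
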